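import Literature.IUT.HodgeTheaters.PuncturedEllipticCoveringsBasic
import HarnessLib

/-!
# [IUTchI] §1: the Galois action on the cusps of `X̲`, and the openness clause of p. 38 (companion interface)

Mochizuki, *Inter-universal Teichmüller theory I*, kurims manuscript (May 2020), §1 p. 37–38
([IUTchI] §1 pp.37–38) [claim: Mochizuki2012, status: disputed] (D-0012 claim key, series status
DISPUTED — nothing here is asserted; this file is an INTERFACE companion plus pure group theory), read
together with *The étale theta function …* ([EtTh]) Def. 2.1 and Rmk. 2.1.1, kurims p. 33.

ADDITIVE COMPANION of the frozen `PuncturedEllipticData` (`PuncturedEllipticCoverings.lean`, abc-iut-L5-t1):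
two pieces of the printed set-up that the frozen fields do NOT determine (answer to the interface
requests IR-A = GAP-LEDGER G-L5t4g3-1 of abc-iut-L5-t4 and G-L5t2g4-1 of abc-iut-L5-t2; no frozen byte is
edited, nothing is restated):

* `PuncturedEllipticData.CuspGalois D` — the action of `Gal(X̲/C) = Π_C/Π_X̲` on the cusps of `X̲`.
  Print: `X̲ := C̲ ×_C X` is "of type `(1,l-tors)`" ([IUTchI] §1 p. 37), i.e. ([EtTh] Def. 2.1 p. 33)
  `X̲ → X` is the covering determined by a rank one quotient `Π_X ↠ Q (≅ ℤ/lℤ)` trivial on the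
  decomposition group of the cusp of `X`: "`X̲ → X` is [by construction] Galois, with `Gal(X̲/X) ≅ Q`",
  "every cusp of `X̲` is `K`-rational" — so the `l` cusps of `X̲` over the unique cusp of `X` form ONE
  `Gal(X̲/X)`-orbit, a torsor; `ι̲` is "multiplication by `−1` on the underlying elliptic curve relative to
  choosing [a] cusp of `X̲` as origin", `C̲ := X̲/ι̲`, and "`ι̲` acts on `Q` by multiplication by `−1`"
  (Rmk. 2.1.1) — so `Gal(X̲/C) = Q ⋊ {±1}` (the `𝔽_l^{⋊±}` of [IUTchI] Def. 6.1 (i), (v) p. 158: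
  "`Aut_K(X̲_K) ⥲ … ⥲ 𝔽_l^{⋊±}`", "acts transitively on the cusps of `X̲_K`"); [IUTchI] §1 p. 37: `ε⁰` is
  "the unique zero cusp of `X̲`", `ε′, ε″` are "the two cusps of `X̲` that lie over `ε̲`" (an `ι̲`-orbit), and
  `2ε̲` is "the cusp whose inverse images in `X̲` correspond to the points … obtained by multiplying `ε′, ε″`
  by `2`, relative to the group law … determined by the pair `(X̲, ε⁰)`".  In the frozen structure the cusps
  are a bare index type `Cusp` with chosen decomposition groups `decomp x ≤ Π_X̲` (representatives of
  `Π_X̲`-conjugacy classes) and NAMES `ε0, ε1, ε2, twoε`; the companion supplies the permutation action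
  `act : Π_C →* Perm Cusp` with laws quoting the sentences above (`g·D_x·g⁻¹` is `Π_X̲`-conjugate to
  `D_{g·x}`; distinct cusps have non-`Π_X̲`-conjugate decomposition groups, cf. abc-iut-L4-t1's
  `CuspidalData.eq_of_conj`; `Gal(X̲/X)` acts freely, transitively, through a cyclic group; `ι̲ = −1` on
  `Q`; `ι̲ ε⁰ = ε⁰`, `ι̲ ε′ = ε″`; `2ε ∈ {2ε′, 2ε″}`).  The action is UNIQUELY determined by the laws
  (`CuspGalois.act_eq_act`), so the datum is no additional choice.
* `PuncturedEllipticData.ArrowOpenClaims D : Prop` — p. 38: the arrows `Π_{X̲→} → Π_X̲`, `Π_{C̲→} → Π_C̲` of the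
  cartesian diagram are "open immersions [with normal image] of profinite groups": `Π_{X̲→}`, `Π_{C̲→}`
  (the CONSTRUCTED `piXarrow`, `piCarrow`) are OPEN in `Π_C` (the frozen `ArrowCoveringClaims` records
  normality, indices and cyclicity but not the word "open"; consumer [IUTchI] Def. 3.1 (f) p. 63 "open
  subgroups `Π_{X̲→K} ⊆ Π_{C̲→K} ⊆ Π_{C_F}`", abc-iut-L5-t2 `InitialThetaData.goodLocalFrobenioidOfEmb (hX)`).

STATEMENTS ONLY here (two structures, the restriction `actX := act|Π_X`); everything DERIVABLE — the
items (b), (d) of G-L5t4g3-1: `Π_X̲` acts trivially, `g ∈ Π_X` acts trivially iff `g ∈ Π_X̲`,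
`Ker(act|Π_X) = Π_X̲`, `Π_X̲ ⊴ Π_X` and `Π_X̲ ⊴ Π_C`, the orbit bijection `Π_X/Π_X̲ ⥲ Cusp(X̲)` (so
`#Cusp = [Π_X : Π_X̲]`, finitely many cusps), `Π_X/Π_X̲` cyclic, `ι̲ ∘ g = g⁻¹ ∘ ι̲`, `ε″ = g₁⁻¹ ε⁰`, and the
uniqueness of `act` — is kernel-checked in the proof-only companion `PuncturedEllipticCoveringsCuspsProofs.lean`.
No instance, no notation; no printed statement is strengthened; no side taken on [IUTchIII] Cor. 3.12.
-/

namespace Literature.IUT.HodgeTheaters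

namespace PuncturedEllipticData

open scoped Pointwise
open Topology Literature.AnabelianGeometry.AbsoluteAnabelian

universe u

variable (D : PuncturedEllipticData.{u})

/-! ### p. 38: `Π_{X̲→} ⊆ Π_X̲`, `Π_{C̲→} ⊆ Π_C̲` are OPEN immersions -/

/-- **[IUTchI] §1 p. 38, openness clause** of the cartesian diagram `X̲→ → X̲`, `C̲→ → C̲` "of finite étale
cyclic coverings of hyperbolic orbicurves and open immersions [with normal image] of profinite groups",
for the data `D`: the constructed subgroups `Π_{X̲→}` (`piXarrow`) and `Π_{C̲→}` (`piCarrow`) are open in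
`Π_C`.  A predicate, not asserted (companion of `ArrowCoveringClaims`, which records the other clauses).
([IUTchI] §1 p.38) [claim: Mochizuki2012, status: disputed] -/
structure ArrowOpenClaims : Prop where
  /-- `Π_{X̲→} ⊆ Π_C` is open -/
  isOpen_piXarrow : IsOpen (D.piXarrow : Set D.PiC)
  /-- `Π_{C̲→} ⊆ Π_C` is open -/
  isOpen_piCarrow : IsOpen (D.piCarrow : Set D.PiC)

/-! ### The Galois action on the cusps of `X̲` -/

/-- INTERFACE DATA+LAWS (companion of `PuncturedEllipticData`; consumers carry it as a parameter):
**the action of `Gal(X̲/C) = Π_C/Π_X̲` on the cusps of `X̲`** ([IUTchI] §1 p. 37 with [EtTh] Def. 2.1,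
Rmk. 2.1.1 p. 33).  `act g` is the permutation of the cusps of `X̲` induced by `g ∈ Π_C` (`X̲ → C` is
Galois: `Π_X̲ ⊴ Π_C`, cf. `normal_PiXbar`); on the chosen decomposition groups it is conjugation up to
`Π_X̲`-conjugacy (`act_decomp`), and distinct cusps have non-`Π_X̲`-conjugate decomposition groups
(`eq_of_conj`), so `act` is determined by the frozen data (`act_eq_act`).  The remaining laws:
"`Gal(X̲/X) ≅ Q`" free of rank one over `ℤ/l` acting simply transitively on the `K`-rational cusps of
`X̲` ([EtTh] Def. 2.1: `free`, `transitive`, `exists_generator`); "`ι̲` acts on `Q` by multiplication by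
`−1`" ([EtTh] Rmk. 2.1.1: `conj_mul_mem_PiXbar`, for `ι̲ =` any element of `Π_C̲ ∖ Π_X̲`); `ε⁰` "the unique
zero cusp" is fixed by `ι̲` (`act_ε0`), `ε′, ε″` "the two cusps of `X̲` that lie over `ε̲`" (`act_ε1`),
`2ε̲` the cusp under `2·ε′, 2·ε″` "relative to the group law … determined by `(X̲, ε⁰)`" (`act_twoε`);
decomposition groups are closed ([AbsTopIII] Prop. 1.4 (i), as in abc-iut-L4-t1's `CuspidalData`).
([IUTchI] §1 p.37) [claim: Mochizuki2012, status: disputed] -/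
structure CuspGalois : Type u where
  /-- the permutation action of `Π_C` on the cusps of `X̲` (through `Gal(X̲/C) = Π_C/Π_X̲`) -/
  act : D.PiC →* Equiv.Perm D.Cusp
  /-- `g·D_x·g⁻¹` is `Π_X̲`-conjugate to the chosen decomposition group of the cusp `g·x` -/
  act_decomp : ∀ (g : D.PiC) (x : D.Cusp),
    ∃ t ∈ D.PiXbar, MulAut.conj (t * g) • D.decomp x = D.decomp (act g x)
  /-- distinct cusps of `X̲` have non-`Π_X̲`-conjugate decomposition groups -/
  eq_of_conj : ∀ (x y : D.Cusp) (t : D.PiC), t ∈ D.PiXbar →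
    MulAut.conj t • D.decomp x = D.decomp y → x = y
  /-- decomposition groups are closed -/
  isClosed_decomp : ∀ x : D.Cusp, IsClosed (D.decomp x : Set D.PiC)
  /-- `Gal(X̲/X) = Π_X/Π_X̲` acts freely on the cusps of `X̲` … -/
  free : ∀ g ∈ D.PiX, ∀ x : D.Cusp, act g x = x → g ∈ D.PiXbar
  /-- … and transitively (every cusp of `X̲` is rational and lies over the one cusp of `X`) … -/
  transitive : ∀ x y : D.Cusp, ∃ g ∈ D.PiX, act g x = y
  /-- … through a cyclic group `Q` ("free `ℤ/lℤ`-module of rank `1`") -/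
  exists_generator : ∃ g ∈ D.PiX, ∀ h ∈ D.PiX, ∃ n : ℤ, act h = act g ^ n
  /-- `ι̲ ∈ Gal(X̲/C̲)`, i.e. any `c ∈ Π_C̲ ∖ Π_X̲`, acts on `Q = Π_X/Π_X̲` by `−1`: `c g c⁻¹ ≡ g⁻¹ (mod Π_X̲)` -/
  conj_mul_mem_PiXbar : ∀ c ∈ D.PiCbar, c ∉ D.PiX → ∀ g ∈ D.PiX, c * g * c⁻¹ * g ∈ D.PiXbar
  /-- `ι̲` fixes the zero cusp `ε⁰` (so does all of `Π_C̲`) -/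
  act_ε0 : ∀ c ∈ D.PiCbar, act c D.ε0 = D.ε0
  /-- `ι̲` switches the two cusps `ε′, ε″` over the cusp `ε̲` of `C̲` -/
  act_ε1 : ∀ c ∈ D.PiCbar, c ∉ D.PiX → act c D.ε1 = D.ε2
  /-- the chosen cusp over `2ε̲` is `2·ε′` or `2·ε″` for the group law with origin `ε⁰` -/
  act_twoε : ∀ g ∈ D.PiX, act g D.ε0 = D.ε1 →
    act (g * g) D.ε0 = D.twoε ∨ act (g⁻¹ * g⁻¹) D.ε0 = D.twoε

namespace CuspGalois

variable {D} (C : D.CuspGalois)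

/-- The action restricted to `Π_X` (a homomorphism `Π_X → Perm Cusp(X̲)`; its image is `Gal(X̲/X)` acting,
its kernel is `Π_X̲` — `PuncturedEllipticCoveringsCuspsProofs`). ([IUTchI] §1 p.37)
[claim: Mochizuki2012, status: disputed] -/
def actX : D.PiX →* Equiv.Perm D.Cusp := C.act.comp D.PiX.subtype

/-- `actX g = act g`. ([IUTchI] §1 p.37) [claim: Mochizuki2012, status: disputed] -/
theorem actX_apply (g : D.PiX) : C.actX g = C.act (g : D.PiC) := rfl

end CuspGalois

end PuncturedEllipticData

end Literature.IUT.HodgeTheaters
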